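import Summits.AtomisticToContinuum.Crystallization.Theorems.ChargedEnergyGapChartDialC
import HarnessLib

/-!
# `ChargedEnergyGap` — the EXPOSURE DIAL on the gross piece: an exact split of `GrossChargeGap θ` into an
# ENERGETICALLY EXPOSED piece (priced by surgery at chemical potential `e*`) and a COMPACT residual, plus the
# regime dial whose dense end is `e*`-free (cell `decomp-a2c`, lens 3, generation 41, node «ExposureDial», part B)

Decomposition node on `ChargedEnergyGapChartDial.GrossChargeGap (3/20)` — the GROSS piece of the exact chart dial
`chargedEnergyGap_iff_pieces (3/20) : ChargedEnergyGap ↔ GrossChargeGap (3/20) ∧ ChartedChargePricing (3/20)` of the shared crux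
`PricedLinkCensus.ChargedEnergyGap` (`stmt-AtomisticToContinuum-14231`; slot `hCEG` of every cone of `stmt-…-31280`).  The charted
piece has been worked down to two computational leaves (generations 37–40); the gross piece — `κ` per charged motif site whose
own-scale first shell is not `θ`-close to a kissing pattern, RELATIVE TO THE UNKNOWN `e*` — was tagged IDEA-NEEDED · BARRIER-ringed
(TetrahedralFrustration, IcosahedralClusters, SutoDegenerateGroundStates, KissingTwelveDegeneracy) and decomposed by nobody.

## TRANSLATION (the one allowed EQUIV, cited pattern): pricing = surgery at chemical potential `e*`

`#F·(e(Q) − e*) = sup_{Q'} #F·(e(Q) − e(Q'))` (`ChargedEnergyGapChartDialC.exists_competitor_of_le_excess`, the infimum trick): a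
species of motif sites is priced iff every configuration admits a competitor gaining `κ` per member.  Part A
(`ChargedEnergyGapGrossSurgery`, finite language, PROVED) exhibits the two competitors that need NO knowledge of `e*`:
DELETE a separated family of RATTLERS (`u ≥ e* + ε`), INSERT particles at a separated family of HOLES (`φ ≤ e* − ε`) — in both
cases `e*` enters only as a lower bound of periodic energies (`card_mul_eStar_le`), i.e. from above.

## SPLIT BENEATH (exact, §3): sort gross charged motif sites by ONE energetic predicate

`Exposed ε R Q x := Rattler ε Q x ∨ NearHole ε R Q x` (`u_Q(x) ≥ e* + ε`, or an `ε`-hole of `Q` within distance `R` of `x`):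

  `GrossChargeGap θ ↔ ExposedGrossPricing θ ε R ∧ CompactGrossGap θ ε R`   (`grossChargeGap_iff_exposed_compact`, every `θ ε R`)

* `ExposedGrossPricing θ ε R` — piece · WEAKER(proved `exposedGrossPricing_of_grossChargeGap`; separating species for the converse:
  tcp / Frank–Kasper bulk, well bound and hole-free — invisible to this piece, binding for the target) · ATTACKABLE-M: energy input
  = part A, PROVED for every finite `1/3`-separated configuration and the WHOLE species (`card_exposed_le_excess_third`:
  `ε·(#rattlers + #hole-neighbours) ≤ ((32/5)³ + (6R + 32/5)³)·(E(y) − N·e*)`, nets + packing included); remaining: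
  (ii) the periodic transfer (blocks of `k³` cells, deep sites, tails — pattern `ChargedEnergyGapNegative.periodicPricing_of_noBoundary`),
  (iii) the hard-core lift for this species (pattern `PricedLinkCensusChargedEnergyGapRegularise` / `…ChargeRecount`; the one
  non-mechanical point: closest-pair deletions can only RAISE a hole's field by the deleted attractive mass, so the recount runs at two
  tolerances `ε ↦ ε/2`).  TRUE for every `ε > 0`, `R ≥ 0` (no truth risk: it is a theorem schema awaiting plumbing).
* `CompactGrossGap θ ε R` — piece · WEAKER(proved `compactGrossGap_of_grossChargeGap`) · the RESIDUAL OF RECORD of the gross side: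
  charged, uncharted, bound better than `|e*| − ε`, no `ε`-hole within `R` — the compact frustration core (tcp / icosahedral /
  bcc-like / amorphous matter, relaxed void walls).  IDEA-NEEDED · BARRIER-ringed as before, but now HOLE-FREE AND WELL-BOUND BY
  DEFINITION, which is what the regime dial below exploits.

DIAL: `Exposed` grows as `ε ↓` and `R ↑` (`exposed_mono`), so the residual SHRINKS (`compactGrossGap_of_le`) while the exposed piece's
constant degrades like `ε/(6R + 32/5)³`; recommended `(ε, R) = (1/10, 6/5)` (vacancy neighbours: the vacant site is a hole of depth
`2e(host) ≈ −1.435 ≤ e* − 1/10` granted `e* ≥ −1.3`; rattlers: adatoms, ledge atoms, under-coordinated cluster surfaces).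

## REGIME DIAL on the residual and `e*`-ELIMINATION of its dense end (§1, §4)

For any count `c` and fraction `φ₀`: `SpeciesPricing c ↔ DensePricing c φ₀ ∧ DilutePricing c φ₀` (trivial case split), and for
`φ₀ > 0` the dense regime is EXACTLY a comparison with ONE periodic competitor (`densePricing_iff_universalCompetitor`, infimum trick):
`DensePricing c φ₀ ↔ ∃ B, ∃ κ > 0, ∀ Q, φ₀·#F ≤ c(Q) → κ·c(Q) ≤ #F·(e(Q) − e(B))` — NO `e*`.  On the compact gross count this types
the tetrahedral-frustration core as one absolute inequality: «periodic matter with `≥ φ₀` compact-gross sites per motif site lies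
`κφ₀` above SOME fixed periodic configuration» (instantiated `B :=` relaxed hcp it is the value-crystallization inequality restricted
to frustrated competitors; BARRIER `TetrahedralFrustration`: needs a `(κφ₀)`-sharp lower bound for gross-rich matter, hybrid not
pure-local; INSTRUMENTABLE: census relative zoo at `φ₀`-mixtures, floor of record `2.2·10⁻²`/site for tcp species); the DILUTE end
(isolated compact gross defects in otherwise unconstrained near-optimal matter) is the IDEA-NEEDED residual (defect coercivity with
an unknown matrix; the stacking-blindness remark of `SurfaceTensionFirst.ExposedSitesCost` applies: the bulk must be priced exactly).

CONE (§5): `grossChargeGap_of_exposureDial : ExposedGrossPricing θ ε R → UniversalCompetitor (compact) φ₀ → DilutePricing (compact) φ₀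
→ GrossChargeGap θ`, and with the charted piece `chargedEnergyGap_of_exposureDial … → ChartedChargePricing θ → ChargedEnergyGap`.

All `[this work]`; cited: `card_mul_sub_le_excess`, `exists_lt_of_ciInf_lt` (the infimum trick of `ChargedEnergyGapChartDialC`),
`natCard_subtype_split`, `chargedEnergyGap_of_pieces`.
-/

noncomputable section

open Literature.MathematicalPhysics.StatisticalMechanics
open Literature.Geometry.DiscreteGeometry
open Summit.AtomisticToContinuum.Crystallization.Theses.PricedLinkCensus
open Summit.AtomisticToContinuum.Crystallization.Theorems.ChargedEnergyGapNegative

namespace Summit.AtomisticToContinuum.Crystallization.Theorems.ChargedEnergyGapChartDial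

/-! ## §1 Pricing a species of motif sites: generic bookkeeping, the regime dial, the universal competitor -/

/-- **Pricing of a motif-site count** `c` against the excess: `∃ κ > 0, ∀ Q, κ · c(Q) ≤ #F · (e(Q) − e*)`. -/
def SpeciesPricing (c : PeriodicConfiguration 3 → ℕ) : Prop :=
  ∃ κ : ℝ, 0 < κ ∧ ∀ Q : PeriodicConfiguration 3, κ * (c Q : ℝ) ≤ excess Q

/-- `GrossChargeGap θ` is the pricing of the gross charged count (definitional). -/
theorem grossChargeGap_iff_speciesPricing (θ : ℝ) :
    GrossChargeGap θ ↔ SpeciesPricing (motifChargedGross θ) := Iff.rfl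

/-- Equal counts have the same pricing. -/
theorem speciesPricing_congr {c c' : PeriodicConfiguration 3 → ℕ} (h : ∀ Q, c Q = c' Q) :
    SpeciesPricing c ↔ SpeciesPricing c' := by
  obtain rfl : c = c' := funext h
  exact Iff.rfl

/-- A smaller count inherits the pricing. -/
theorem SpeciesPricing.mono {c c' : PeriodicConfiguration 3 → ℕ} (h : SpeciesPricing c) (hle : ∀ Q, c' Q ≤ c Q) :
    SpeciesPricing c' := by
  obtain ⟨κ, hκ, hc⟩ := h
  exact ⟨κ, hκ, fun Q => (mul_le_mul_of_nonneg_left (Nat.cast_le.2 (hle Q)) hκ.le).trans (hc Q)⟩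

/-- Two priced counts are priced together (constant `min(κ₁, κ₂)/2`). -/
theorem SpeciesPricing.add {c₁ c₂ : PeriodicConfiguration 3 → ℕ} (h₁ : SpeciesPricing c₁) (h₂ : SpeciesPricing c₂) :
    SpeciesPricing (fun Q => c₁ Q + c₂ Q) := by
  obtain ⟨κ₁, hκ₁, h₁⟩ := h₁
  obtain ⟨κ₂, hκ₂, h₂⟩ := h₂
  refine ⟨min κ₁ κ₂ / 2, by positivity, fun Q => ?_⟩
  have hc1 : (0 : ℝ) ≤ c₁ Q := Nat.cast_nonneg _
  have hc2 : (0 : ℝ) ≤ c₂ Q := Nat.cast_nonneg _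
  have hm1 := mul_le_mul_of_nonneg_right (min_le_left κ₁ κ₂) hc1
  have hm2 := mul_le_mul_of_nonneg_right (min_le_right κ₁ κ₂) hc2
  push_cast
  linarith [h₁ Q, h₂ Q]

/-- **Additivity of pricing**: a sum of counts is priced iff both summands are. -/
theorem speciesPricing_add_iff (c₁ c₂ : PeriodicConfiguration 3 → ℕ) :
    SpeciesPricing (fun Q => c₁ Q + c₂ Q) ↔ SpeciesPricing c₁ ∧ SpeciesPricing c₂ :=
  ⟨fun h => ⟨h.mono fun _ => Nat.le_add_right _ _, h.mono fun _ => Nat.le_add_left _ _⟩, fun h => h.1.add h.2⟩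

/-- **Dense regime**: the count is priced on the configurations where it is at least the fraction `φ₀` of the motif. -/
def DensePricing (c : PeriodicConfiguration 3 → ℕ) (φ₀ : ℝ) : Prop :=
  ∃ κ : ℝ, 0 < κ ∧ ∀ Q : PeriodicConfiguration 3,
    φ₀ * (Q.motif.card : ℝ) ≤ (c Q : ℝ) → κ * (c Q : ℝ) ≤ excess Q

/-- **Dilute regime**: the count is priced on the configurations where it is below the fraction `φ₀` of the motif. -/
def DilutePricing (c : PeriodicConfiguration 3 → ℕ) (φ₀ : ℝ) : Prop :=
  ∃ κ : ℝ, 0 < κ ∧ ∀ Q : PeriodicConfiguration 3,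
    (c Q : ℝ) < φ₀ * (Q.motif.card : ℝ) → κ * (c Q : ℝ) ≤ excess Q

/-- **The regime dial** (exact, trivial glue): priced iff priced in both regimes, for every threshold `φ₀`. -/
theorem speciesPricing_iff_dense_dilute (c : PeriodicConfiguration 3 → ℕ) (φ₀ : ℝ) :
    SpeciesPricing c ↔ DensePricing c φ₀ ∧ DilutePricing c φ₀ := by
  constructor
  · rintro ⟨κ, hκ, h⟩
    exact ⟨⟨κ, hκ, fun Q _ => h Q⟩, ⟨κ, hκ, fun Q _ => h Q⟩⟩
  · rintro ⟨⟨κ₁, hκ₁, h₁⟩, ⟨κ₂, hκ₂, h₂⟩⟩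
    refine ⟨min κ₁ κ₂, lt_min hκ₁ hκ₂, fun Q => ?_⟩
    have hc : (0 : ℝ) ≤ c Q := Nat.cast_nonneg _
    rcases le_or_gt (φ₀ * (Q.motif.card : ℝ)) (c Q : ℝ) with hd | hd
    · exact (mul_le_mul_of_nonneg_right (min_le_left _ _) hc).trans (h₁ Q hd)
    · exact (mul_le_mul_of_nonneg_right (min_le_right _ _) hc).trans (h₂ Q hd)

/-- **Universal competitor** (the `e*`-FREE form of the dense regime): ONE periodic configuration `B` beats every configuration
of the dense regime by `κ` per member of the species. -/
def UniversalCompetitor (c : PeriodicConfiguration 3 → ℕ) (φ₀ : ℝ) : Prop :=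
  ∃ B : PeriodicConfiguration 3, ∃ κ : ℝ, 0 < κ ∧ ∀ Q : PeriodicConfiguration 3,
    φ₀ * (Q.motif.card : ℝ) ≤ (c Q : ℝ) →
      κ * (c Q : ℝ) ≤ (Q.motif.card : ℝ) * (Q.energyPerParticle lennardJones - B.energyPerParticle lennardJones)

/-- A universal competitor prices the dense regime (`e* ≤ e(B)`). -/
theorem densePricing_of_universalCompetitor {c : PeriodicConfiguration 3 → ℕ} {φ₀ : ℝ}
    (h : UniversalCompetitor c φ₀) : DensePricing c φ₀ := by
  obtain ⟨B, κ, hκ, h⟩ := h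
  exact ⟨κ, hκ, fun Q hd => (h Q hd).trans (card_mul_sub_le_excess Q B)⟩

/-- **`e*`-elimination in the dense regime** (infimum trick): if the dense regime is priced with constant `κ`, any periodic `B`
with `e(B) < e* + κφ₀/2` is a universal competitor with constant `κ/2` — in the dense regime the required gain `κ·c ≥ κφ₀·#F` is
EXTENSIVE, so a fixed near-optimal competitor absorbs the defect `#F·(e(B) − e*)`. -/
theorem universalCompetitor_of_densePricing {c : PeriodicConfiguration 3 → ℕ} {φ₀ : ℝ} (hφ : 0 < φ₀)
    (h : DensePricing c φ₀) : UniversalCompetitor c φ₀ := by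
  obtain ⟨κ, hκ, h⟩ := h
  have hlt : eStar < eStar + κ * φ₀ / 2 := lt_add_of_pos_right _ (by positivity)
  obtain ⟨B, hB⟩ :=
    exists_lt_of_ciInf_lt (f := fun Q : PeriodicConfiguration 3 => Q.energyPerParticle lennardJones) hlt
  refine ⟨B, κ / 2, by positivity, fun Q hd => ?_⟩
  have hQ : κ * (c Q : ℝ) ≤ (Q.motif.card : ℝ) * (Q.energyPerParticle lennardJones - eStar) := h Q hd
  have hF : (0 : ℝ) ≤ Q.motif.card := Nat.cast_nonneg _
  have hB' : B.energyPerParticle lennardJones - eStar ≤ κ * φ₀ / 2 := by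
    have : B.energyPerParticle lennardJones < eStar + κ * φ₀ / 2 := hB
    linarith
  have h1 : (Q.motif.card : ℝ) * (B.energyPerParticle lennardJones - eStar) ≤ (Q.motif.card : ℝ) * (κ * φ₀ / 2) :=
    mul_le_mul_of_nonneg_left hB' hF
  have h2 : κ / 2 * (φ₀ * (Q.motif.card : ℝ)) ≤ κ / 2 * (c Q : ℝ) := mul_le_mul_of_nonneg_left hd (by positivity)
  have h3 : (Q.motif.card : ℝ) * (κ * φ₀ / 2) = κ / 2 * (φ₀ * (Q.motif.card : ℝ)) := by ring
  have h4 : (Q.motif.card : ℝ) * (Q.energyPerParticle lennardJones - B.energyPerParticle lennardJones) =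
      (Q.motif.card : ℝ) * (Q.energyPerParticle lennardJones - eStar) -
        (Q.motif.card : ℝ) * (B.energyPerParticle lennardJones - eStar) := by ring
  rw [h4]
  linarith

/-- **The dense regime is exactly a universal-competitor comparison** (`φ₀ > 0`). -/
theorem densePricing_iff_universalCompetitor {c : PeriodicConfiguration 3 → ℕ} {φ₀ : ℝ} (hφ : 0 < φ₀) :
    DensePricing c φ₀ ↔ UniversalCompetitor c φ₀ :=
  ⟨universalCompetitor_of_densePricing hφ, densePricing_of_universalCompetitor⟩

/-! ## §2 The energetic exposure predicates (periodic language, `e*`-relative) -/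

/-- **The field** of `Q` at a point `z`: `φ_Q(z) = Σ_{q ∈ Q.points} V_LJ(|z − q|)` (the binding a particle inserted at `z` would
receive; summable for periodic `Q`, junk `0` is never met on them). -/
def holeField (Q : PeriodicConfiguration 3) (z : E3) : ℝ :=
  ∑' q : Q.points, lennardJones (dist z (q : E3))

/-- **`ε`-hole** of `Q` at `z`: no point of `Q` within `1/2` of `z` (so `z ∉ Q.points`, and insertion keeps injectivity) and field
`φ_Q(z) ≤ e* − ε` — a particle inserted at `z` is bound by at least `|e*| + ε`. -/
def IsHole (ε : ℝ) (Q : PeriodicConfiguration 3) (z : E3) : Prop :=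
  (∀ q ∈ Q.points, (1 : ℝ) / 2 ≤ dist z q) ∧ holeField Q z ≤ eStar - ε

/-- **`ε`-rattler**: a motif site bound by at most `|e*| − ε`, i.e. `u_Q(x) = 2·siteEnergy Q x ≥ e* + ε`. -/
def Rattler (ε : ℝ) (Q : PeriodicConfiguration 3) (x : Q.motif) : Prop :=
  eStar + ε ≤ 2 * siteEnergy Q (x : E3)

/-- **Near a hole**: an `ε`-hole of `Q` within distance `R` (absolute) of the site. -/
def NearHole (ε R : ℝ) (Q : PeriodicConfiguration 3) (x : Q.motif) : Prop :=
  ∃ z : E3, dist (x : E3) z ≤ R ∧ IsHole ε Q z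

/-- **EXPOSED** (the sorting predicate of the dial): rattler or near a hole — the two species priced by one-step surgery at
chemical potential `e*` (part A). -/
def Exposed (ε R : ℝ) (Q : PeriodicConfiguration 3) (x : Q.motif) : Prop :=
  Rattler ε Q x ∨ NearHole ε R Q x

/-- Number of EXPOSED gross charged motif sites. -/
def motifGrossExposed (θ ε R : ℝ) (Q : PeriodicConfiguration 3) : ℕ :=
  Nat.card {x : Q.motif // (Charged Q x ∧ ¬ ChartedAt θ Q (pt Q x)) ∧ Exposed ε R Q x}

/-- Number of COMPACT (= non-exposed) gross charged motif sites — the residual species. -/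
def motifGrossCompact (θ ε R : ℝ) (Q : PeriodicConfiguration 3) : ℕ :=
  Nat.card {x : Q.motif // (Charged Q x ∧ ¬ ChartedAt θ Q (pt Q x)) ∧ ¬ Exposed ε R Q x}

/-- `#gross charged = #compact + #exposed`. -/
theorem motifChargedGross_eq_compact_add_exposed (θ ε R : ℝ) (Q : PeriodicConfiguration 3) :
    motifChargedGross θ Q = motifGrossCompact θ ε R Q + motifGrossExposed θ ε R Q :=
  natCard_subtype_split (fun x : Q.motif => Charged Q x ∧ ¬ ChartedAt θ Q (pt Q x)) (fun x => Exposed ε R Q x)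

/-! ## §3 The pieces and the exact exposure dial -/

/-- piece · WEAKER(proved `exposedGrossPricing_of_grossChargeGap`) · ATTACKABLE-M (finite form PROVED for every `1/3`-separated
configuration: part A `ChargedEnergyGapGrossSurgery.card_exposed_le_excess_third`; remaining: periodic transfer, hard-core lift).
**Exposed gross pricing**: `κ` per gross charged motif site that is an `ε`-rattler or within `R` of an `ε`-hole. -/
def ExposedGrossPricing (θ ε R : ℝ) : Prop :=
  ∃ κ : ℝ, 0 < κ ∧ ∀ Q : PeriodicConfiguration 3, κ * (motifGrossExposed θ ε R Q : ℝ) ≤ excess Q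

/-- piece · WEAKER(proved `compactGrossGap_of_grossChargeGap`) · RESIDUAL OF RECORD of the gross side · IDEA-NEEDED · BARRIER-ringed
(TetrahedralFrustration &c.) · INSTRUMENTABLE(relative zoo restricted to hole-free well-bound species).  **Compact gross gap**: `κ` per
gross charged motif site that is neither an `ε`-rattler nor within `R` of an `ε`-hole. -/
def CompactGrossGap (θ ε R : ℝ) : Prop :=
  ∃ κ : ℝ, 0 < κ ∧ ∀ Q : PeriodicConfiguration 3, κ * (motifGrossCompact θ ε R Q : ℝ) ≤ excess Q

/-- **THE EXPOSURE DIAL IS EXACT**: for every `θ ε R`, `GrossChargeGap θ ↔ ExposedGrossPricing θ ε R ∧ CompactGrossGap θ ε R`. -/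
theorem grossChargeGap_iff_exposed_compact (θ ε R : ℝ) :
    GrossChargeGap θ ↔ ExposedGrossPricing θ ε R ∧ CompactGrossGap θ ε R := by
  rw [grossChargeGap_iff_speciesPricing,
    speciesPricing_congr (c' := fun Q => motifGrossExposed θ ε R Q + motifGrossCompact θ ε R Q)
      (fun Q => by rw [motifChargedGross_eq_compact_add_exposed θ ε R Q, add_comm]),
    speciesPricing_add_iff]
  exact Iff.rfl

/-- The glue of the dial: the two pieces give the gross piece. -/
theorem grossChargeGap_of_exposed_compact {θ ε R : ℝ} (hE : ExposedGrossPricing θ ε R) (hC : CompactGrossGap θ ε R) :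
    GrossChargeGap θ :=
  (grossChargeGap_iff_exposed_compact θ ε R).2 ⟨hE, hC⟩

/-- WEAKER certificate: the exposed piece is implied by the gross piece. -/
theorem exposedGrossPricing_of_grossChargeGap {θ : ℝ} (ε R : ℝ) (hG : GrossChargeGap θ) : ExposedGrossPricing θ ε R :=
  ((grossChargeGap_iff_exposed_compact θ ε R).1 hG).1

/-- WEAKER certificate: the compact residual is implied by the gross piece. -/
theorem compactGrossGap_of_grossChargeGap {θ : ℝ} (ε R : ℝ) (hG : GrossChargeGap θ) : CompactGrossGap θ ε R :=
  ((grossChargeGap_iff_exposed_compact θ ε R).1 hG).2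

/-- … and both by the crux itself. -/
theorem compactGrossGap_of_chargedEnergyGap (θ ε R : ℝ) (h : ChargedEnergyGap) : CompactGrossGap θ ε R :=
  compactGrossGap_of_grossChargeGap ε R (grossChargeGap_of_chargedEnergyGap θ h)

/-! ## §4 The dial in `(ε, R)`: exposure grows as `ε ↓`, `R ↑`; the residual shrinks -/

/-- `isHole_anti`: monotonicity / bookkeeping lemma of this file (see the module docstring). [formal bookkeeping] -/
theorem isHole_anti {ε ε' : ℝ} (h : ε ≤ ε') {Q : PeriodicConfiguration 3} {z : E3} (hz : IsHole ε' Q z) : IsHole ε Q z :=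
  ⟨hz.1, hz.2.trans (by linarith)⟩

/-- `rattler_anti` (monotonicity / bookkeeping lemma of this file; see the module docstring). [formal bookkeeping] -/
theorem rattler_anti {ε ε' : ℝ} (h : ε ≤ ε') {Q : PeriodicConfiguration 3} {x : Q.motif} (hx : Rattler ε' Q x) :
    Rattler ε Q x :=
  le_trans (by unfold Rattler at hx; linarith) hx

/-- `nearHole_mono` (monotonicity / bookkeeping lemma of this file; see the module docstring). [formal bookkeeping] -/
theorem nearHole_mono {ε ε' R R' : ℝ} (hε : ε ≤ ε') (hR : R' ≤ R) {Q : PeriodicConfiguration 3} {x : Q.motif}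
    (hx : NearHole ε' R' Q x) : NearHole ε R Q x := by
  obtain ⟨z, hz, hh⟩ := hx
  exact ⟨z, hz.trans hR, isHole_anti hε hh⟩

/-- Exposure is monotone in the dial: `ε ≤ ε'`, `R' ≤ R` ⇒ `Exposed ε' R' → Exposed ε R`. -/
theorem exposed_mono {ε ε' R R' : ℝ} (hε : ε ≤ ε') (hR : R' ≤ R) {Q : PeriodicConfiguration 3} {x : Q.motif}
    (hx : Exposed ε' R' Q x) : Exposed ε R Q x :=
  hx.elim (fun h => Or.inl (rattler_anti hε h)) fun h => Or.inr (nearHole_mono hε hR h)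

/-- `motifGrossExposed_mono` (monotonicity / bookkeeping lemma of this file; see the module docstring). [formal bookkeeping] -/
theorem motifGrossExposed_mono {θ ε ε' R R' : ℝ} (hε : ε ≤ ε') (hR : R' ≤ R) (Q : PeriodicConfiguration 3) :
    motifGrossExposed θ ε' R' Q ≤ motifGrossExposed θ ε R Q :=
  Nat.card_le_card_of_injective
    (fun x : {x : Q.motif // (Charged Q x ∧ ¬ ChartedAt θ Q (pt Q x)) ∧ Exposed ε' R' Q x} =>
      (⟨x.1, x.2.1, exposed_mono hε hR x.2.2⟩ :
        {x : Q.motif // (Charged Q x ∧ ¬ ChartedAt θ Q (pt Q x)) ∧ Exposed ε R Q x}))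
    (fun x y h => Subtype.ext (by have h' := congrArg Subtype.val h; simpa using h'))

/-- `motifGrossCompact_mono` (monotonicity / bookkeeping lemma of this file; see the module docstring). [formal bookkeeping] -/
theorem motifGrossCompact_mono {θ ε ε' R R' : ℝ} (hε : ε ≤ ε') (hR : R' ≤ R) (Q : PeriodicConfiguration 3) :
    motifGrossCompact θ ε R Q ≤ motifGrossCompact θ ε' R' Q :=
  Nat.card_le_card_of_injective
    (fun x : {x : Q.motif // (Charged Q x ∧ ¬ ChartedAt θ Q (pt Q x)) ∧ ¬ Exposed ε R Q x} =>
      (⟨x.1, x.2.1, fun h => x.2.2 (exposed_mono hε hR h)⟩ :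
        {x : Q.motif // (Charged Q x ∧ ¬ ChartedAt θ Q (pt Q x)) ∧ ¬ Exposed ε' R' Q x}))
    (fun x y h => Subtype.ext (by have h' := congrArg Subtype.val h; simpa using h'))

/-- **The residual shrinks along the dial**: pricing the compact sites at `(ε', R')` prices them at every `ε ≤ ε'`, `R ≥ R'`. -/
theorem compactGrossGap_of_le {θ ε ε' R R' : ℝ} (hε : ε ≤ ε') (hR : R' ≤ R) (h : CompactGrossGap θ ε' R') :
    CompactGrossGap θ ε R :=
  SpeciesPricing.mono (c := motifGrossCompact θ ε' R') h (motifGrossCompact_mono hε hR)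

/-- … while the exposed piece gets harder: pricing at `(ε, R)` prices the smaller exposed count at `(ε', R')`. -/
theorem exposedGrossPricing_of_le {θ ε ε' R R' : ℝ} (hε : ε ≤ ε') (hR : R' ≤ R) (h : ExposedGrossPricing θ ε R) :
    ExposedGrossPricing θ ε' R' :=
  SpeciesPricing.mono (c := motifGrossExposed θ ε R) h (motifGrossExposed_mono hε hR)

/-- Monotone in the chart tolerance too: a larger `θ` charts more sites, so fewer are gross. -/
theorem compactGrossGap_mono_theta {θ θ' ε R : ℝ} (h : θ ≤ θ') (hC : CompactGrossGap θ ε R) : CompactGrossGap θ' ε R := by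
  refine SpeciesPricing.mono (c := motifGrossCompact θ ε R) hC fun Q => ?_
  exact Nat.card_le_card_of_injective
    (fun x : {x : Q.motif // (Charged Q x ∧ ¬ ChartedAt θ' Q (pt Q x)) ∧ ¬ Exposed ε R Q x} =>
      (⟨x.1, ⟨x.2.1.1, fun hc => x.2.1.2 (chartedAt_mono h hc)⟩, x.2.2⟩ :
        {x : Q.motif // (Charged Q x ∧ ¬ ChartedAt θ Q (pt Q x)) ∧ ¬ Exposed ε R Q x}))
    (fun x y hxy => Subtype.ext (by have h' := congrArg Subtype.val hxy; simpa using h'))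

/-! ## §5 The regime dial on the residual, its `e*`-free dense end, and the assembled cone -/

/-- The compact residual splits by regime (exact). -/
theorem compactGrossGap_iff_dense_dilute (θ ε R φ₀ : ℝ) :
    CompactGrossGap θ ε R ↔
      DensePricing (motifGrossCompact θ ε R) φ₀ ∧ DilutePricing (motifGrossCompact θ ε R) φ₀ :=
  speciesPricing_iff_dense_dilute _ _

/-- **The dense end of the residual is `e*`-free**: «compact-gross-rich periodic matter lies `κφ₀` above ONE fixed periodic
competitor» — the tetrahedral-frustration core as a single absolute inequality (`φ₀ > 0`). -/
theorem denseCompactGrossGap_iff_universalCompetitor {θ ε R φ₀ : ℝ} (hφ : 0 < φ₀) :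
    DensePricing (motifGrossCompact θ ε R) φ₀ ↔ UniversalCompetitor (motifGrossCompact θ ε R) φ₀ :=
  densePricing_iff_universalCompetitor hφ

/-- **The G-side cone of the node**: exposed pricing ∧ a universal competitor for compact-gross-rich matter ∧ dilute compact pricing
⟹ the gross piece. -/
theorem grossChargeGap_of_exposureDial {θ ε R φ₀ : ℝ} (hE : ExposedGrossPricing θ ε R)
    (hU : UniversalCompetitor (motifGrossCompact θ ε R) φ₀) (hD : DilutePricing (motifGrossCompact θ ε R) φ₀) :
    GrossChargeGap θ :=
  grossChargeGap_of_exposed_compact hE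
    ((compactGrossGap_iff_dense_dilute θ ε R φ₀).2 ⟨densePricing_of_universalCompetitor hU, hD⟩)

/-- **… and the crux by name**, with the charted piece of the chart dial. -/
theorem chargedEnergyGap_of_exposureDial {θ ε R φ₀ : ℝ} (hE : ExposedGrossPricing θ ε R)
    (hU : UniversalCompetitor (motifGrossCompact θ ε R) φ₀) (hD : DilutePricing (motifGrossCompact θ ε R) φ₀)
    (hP : ChartedChargePricing θ) : ChargedEnergyGap :=
  chargedEnergyGap_of_pieces (grossChargeGap_of_exposureDial hE hU hD) hP

/-- WEAKER certificates for the regime pieces: each is implied by the crux (`φ₀ > 0` for the universal competitor). -/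
theorem universalCompetitor_of_chargedEnergyGap {θ ε R φ₀ : ℝ} (hφ : 0 < φ₀) (h : ChargedEnergyGap) :
    UniversalCompetitor (motifGrossCompact θ ε R) φ₀ :=
  universalCompetitor_of_densePricing hφ
    ((compactGrossGap_iff_dense_dilute θ ε R φ₀).1 (compactGrossGap_of_chargedEnergyGap θ ε R h)).1

/-- `diluteCompact_of_chargedEnergyGap` (monotonicity / bookkeeping lemma of this file; see the module docstring). [formal bookkeeping] -/
theorem diluteCompact_of_chargedEnergyGap (θ ε R φ₀ : ℝ) (h : ChargedEnergyGap) :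
    DilutePricing (motifGrossCompact θ ε R) φ₀ :=
  ((compactGrossGap_iff_dense_dilute θ ε R φ₀).1 (compactGrossGap_of_chargedEnergyGap θ ε R h)).2

/-- `exposedGrossPricing_of_chargedEnergyGap` (monotonicity / bookkeeping lemma of this file; see the module docstring). [formal bookkeeping] -/
theorem exposedGrossPricing_of_chargedEnergyGap (θ ε R : ℝ) (h : ChargedEnergyGap) : ExposedGrossPricing θ ε R :=
  exposedGrossPricing_of_grossChargeGap ε R (grossChargeGap_of_chargedEnergyGap θ h)

end Summit.AtomisticToContinuum.Crystallization.Theorems.ChargedEnergyGapChartDial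

end
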